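import Summits.CriticalPhenomena.PercolationContinuityZ3.Theorems.PercAnnulusCrossingIICEdgeBias
import Summits.CriticalPhenomena.PercolationContinuityZ3.Theorems.PercAnnulusCrossingBoxStaircase
import HarnessLib

/-!
# Every edge is open-biased under Kesten's IIC (lane RSW3, p1 gen 8)

builds on p205010 (kernel theorem, internal audit signed; external expert review pending) — NOT used in this file.

RSW3 lane (LANE 3 `prim-rsw3`), seat `prim-rsw3-p1` (gen 8).  Helper file (`--supports stmt-CriticalPhenomena-4575`); no definitions, no sorries.
`…IICEdgeBias` proved `p < ν(s(a,b) open)` for RADIAL edges (`a ∈ Λ(n)`, `b ∉ Λ(n)`).  With the two-staircase lemma of `…BoxStaircase`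
(`Λ(n)` minus a shell point is lattice-connected from `0`) the TANGENTIAL edges (both endpoints on the shell `Λ(n) ∖ Λ(n−1)`) follow, with the
datum `V = Λ(n) ∖ {b}` and the escape ray of `…IICSupport` from `b ∈ ∂ⁱⁿΛ(n)`; hence:

* `iicMeasure_real_tangentialEdge_gt` — `a, b ∈ Λ(n)`, `b ∉ Λ(n−1)`, `n ≥ 1`, `a ∼ b` ⇒ `p < ν(s(a,b) open)`;
* **`iicMeasure_real_latticeEdge_gt`** — for EVERY lattice edge `s(a,b)` of `ℤ^d` (`d ≥ 2`): **`p < ν(s(a,b) ∈ ω)`** for every IIC probability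
  measure `ν` at `p` (`0 < p < 1`) under (A2)□ at aspect `(s,L)` (`1 ≤ s`, `ϰ > 0`).  With p1 gen 7's mixing (`ν(e open) → p_c` as `e → ∞` at `p_c`):
  under the IIC every edge is strictly open-biased and the bias vanishes at infinity.
References: H. Kesten, PTRF 73 (1986) Thm (3); D. Basu, A. Sapozhnikov, ECP 22 (2017) no. 26, Thm 1.1.
-/

noncomputable section

namespace Summit.CriticalPhenomena.PercolationContinuityZ3.Theorems.Crossing

open MeasureTheory Filter Topology Literature.Probability.Percolation Literature.Probability.LatticeModels
open Literature.Probability.Percolation.DCT16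

variable {d : ℕ}

/-- **Tangential edges are open-biased**: `a ∼ b`, `a, b ∈ Λ(n)`, `b ∉ Λ(n−1)`, `n ≥ 1` ⇒ `p < ν(s(a,b) ∈ ω)` (IIC probability measures,
`0 < p < 1`, `d ≥ 2`, (A2)□ at `(s,L)`, `1 ≤ s`, `ϰ > 0`).  Datum: `V = Λ(n) ∖ {b}` (connected from `0` by `pathIn_box_sdiff_singleton_zero`),
escape ray from `b ∈ ∂ⁱⁿΛ(n)` off `V`. [cite: Kesten1986, Thm. (3)] [cite: BasuSapozhnikov2017ECP, Thm. 1.1] -/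
theorem iicMeasure_real_tangentialEdge_gt (hd : 2 ≤ d) (p : unitInterval) (hp : 0 < (p : ℝ)) (hp1 : (p : ℝ) < 1) {s L : ℕ} (hs : 1 ≤ s)
    {ϰ : ℝ} (hϰ : 0 < ϰ) (hA2 : SetToSetQuasiMultAspectAt d p s L ϰ) {ν : Measure (BondConfig (Site d))} [IsProbabilityMeasure ν]
    (hν : ∀ (F : Finset (Sym2 (Site d))) (E : Set (BondConfig (Site d))), MeasurableSet E → DeterminedBy E ↑F →
      Tendsto (fun n : ℕ => (bondPercolation (zdGraph d) p).real (E ∩ siteToBoundary d n) / oneArmProb d p n)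
        atTop (𝓝 (ν.real E)))
    {a b : Site d} (hab : (zdGraph d).Adj a b) {n : ℕ} (hn : 1 ≤ n) (ha : a ∈ box d n) (hbn : b ∈ box d n) (hb : b ∉ box d (n - 1)) :
    (p : ℝ) < ν.real {ω : BondConfig (Site d) | s(a, b) ∈ ω} := by
  classical
  set V : Finset (Site d) := (box d n).erase b with hV
  set G : Finset (Sym2 (Site d)) := (V.sym2).filter (fun e => e ∈ (zdGraph d).edgeSet) with hGdef
  have hGE : ∀ g ∈ G, g ∈ (zdGraph d).edgeSet := fun g hg => (Finset.mem_filter.1 hg).2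
  have hGV : ∀ g ∈ G, ∀ v ∈ g, v ∈ V := fun g hg => Finset.mem_sym2_iff.1 (Finset.mem_filter.1 hg).1
  have hVcoe : (↑V : Set (Site d)) = (↑(box d n) : Set (Site d)) \ {b} := by rw [hV, Finset.coe_erase]
  have h0b : (0 : Site d) ≠ b := fun h => hb (h ▸ zero_mem_box d (n - 1))
  have hVconn : ∀ v ∈ V, PathIn (openGraph (↑G : Set (Sym2 (Site d)))) (↑V : Set (Site d)) 0 v := by
    intro v hv
    have hv' := Finset.mem_erase.1 hv
    have hP := pathIn_box_sdiff_singleton_zero hn hv'.2 hb hv'.1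
    rw [← hVcoe] at hP
    refine pathIn_map (f := id) (fun z hz => hz) (fun z w hz hw hzw => ?_) hP
    rw [openGraph_adj]
    refine ⟨Finset.mem_coe.2 (Finset.mem_filter.2 ⟨Finset.mem_sym2_iff.2 fun x hx => ?_, (SimpleGraph.mem_edgeSet _).2 hzw⟩), hzw.ne⟩
    rcases Sym2.mem_iff.1 hx with rfl | rfl
    · exact Finset.mem_coe.1 hz
    · exact Finset.mem_coe.1 hw
  have hbm : b ∈ box d (n + 1) := box_mono d (Nat.le_succ n) hbn
  have hbib : b ∈ innerBoundary (zdGraph d) (box d n) := mem_innerBoundary_box_of_notMem_pred hn hbn hb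
  have hVm : V ⊆ box d (n + 1 - 1) := by rw [Nat.add_sub_cancel]; exact Finset.erase_subset _ _
  have hesc : 0 < (bondPercolation (zdGraph d) p).real {ω : BondConfig (Site d) | ∃ x ∈ ({b} : Finset (Site d)),
      ∃ t ∈ innerBoundary (zdGraph d) (box d (s * (n + 1))), ω ∈ openConnIn ((↑(box d (s * (n + 1))) : Set (Site d)) \ ↑V) x t} := by
    have haN : n ≤ s * (n + 1) := (Nat.le_succ n).trans (Nat.le_mul_of_pos_left (n + 1) (by omega))
    exact lt_of_lt_of_le (pow_pos hp _) (pow_le_real_link_sdiff_single (d := d) p haN hbib)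
  exact iicMeasure_real_edge_gt (by omega) p hp hp1 hs hϰ hA2 hν hab (Finset.mem_erase.2 ⟨h0b, zero_mem_box d n⟩)
    (Finset.mem_erase.2 ⟨hab.ne, ha⟩) hGE hGV hVconn (by omega) hVm hbm hesc

/-- **EVERY LATTICE EDGE IS OPEN-BIASED UNDER KESTEN'S IIC: `p < ν(s(a,b) ∈ ω)`** for every edge `a ∼ b` of `ℤ^d` (`d ≥ 2`), every IIC
probability measure `ν` at `p` (`0 < p < 1`) under (A2)□ at aspect `(s,L)` (`1 ≤ s`, `ϰ > 0`): by the trichotomy of the shell indices of `a` and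
`b` (radial: `…IICEdgeBias`; tangential: `iicMeasure_real_tangentialEdge_gt`). [cite: Kesten1986, Thm. (3)] [cite: BasuSapozhnikov2017ECP, Thm. 1.1] -/
theorem iicMeasure_real_latticeEdge_gt (hd : 2 ≤ d) (p : unitInterval) (hp : 0 < (p : ℝ)) (hp1 : (p : ℝ) < 1) {s L : ℕ} (hs : 1 ≤ s)
    {ϰ : ℝ} (hϰ : 0 < ϰ) (hA2 : SetToSetQuasiMultAspectAt d p s L ϰ) {ν : Measure (BondConfig (Site d))} [IsProbabilityMeasure ν]
    (hν : ∀ (F : Finset (Sym2 (Site d))) (E : Set (BondConfig (Site d))), MeasurableSet E → DeterminedBy E ↑F →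
      Tendsto (fun n : ℕ => (bondPercolation (zdGraph d) p).real (E ∩ siteToBoundary d n) / oneArmProb d p n)
        atTop (𝓝 (ν.real E)))
    {a b : Site d} (hab : (zdGraph d).Adj a b) :
    (p : ℝ) < ν.real {ω : BondConfig (Site d) | s(a, b) ∈ ω} := by
  classical
  obtain ⟨N, hN⟩ := exists_subset_box ({a, b} : Finset (Site d))
  have haN : a ∈ box d N := hN (by simp)
  have hbN : b ∈ box d N := hN (by simp)
  have hea : ∃ n, a ∈ box d n := ⟨N, haN⟩
  have heb : ∃ n, b ∈ box d n := ⟨N, hbN⟩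
  set na := Nat.find hea with hna
  set nb := Nat.find heb with hnb
  have ha : a ∈ box d na := Nat.find_spec hea
  have hb : b ∈ box d nb := Nat.find_spec heb
  have hamin : ∀ m, m < na → a ∉ box d m := fun m hm => Nat.find_min hea hm
  have hbmin : ∀ m, m < nb → b ∉ box d m := fun m hm => Nat.find_min heb hm
  rcases lt_trichotomy na nb with h | h | h
  · -- radial, `a` inside
    exact iicMeasure_real_radialEdge_gt hd p hp hp1 hs hϰ hA2 hν hab (n := nb - 1) (box_mono d (by omega) ha) (hbmin _ (by omega))
  · -- tangential (same shell); the shell index is `≥ 1` since `a ≠ b`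
    have hn1 : 1 ≤ na := by
      by_contra h0
      have h0' : na = 0 := by omega
      apply hab.ne
      have ha0 : a ∈ box d 0 := h0' ▸ ha
      have hb0 : b ∈ box d 0 := by rw [← h0', h]; exact hb
      rw [mem_box] at ha0 hb0
      funext i
      have := ha0 i; have := hb0 i
      push_cast at *
      omega
    exact iicMeasure_real_tangentialEdge_gt hd p hp hp1 hs hϰ hA2 hν hab hn1 ha (h ▸ hb) (h ▸ hbmin _ (by omega))
  · -- radial, `b` inside: swap the endpoints
    rw [Sym2.eq_swap]
    exact iicMeasure_real_radialEdge_gt hd p hp hp1 hs hϰ hA2 hν hab.symm (n := na - 1) (box_mono d (by omega) hb) (hamin _ (by omega))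

end Summit.CriticalPhenomena.PercolationContinuityZ3.Theorems.Crossing
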